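import Summits.Ventures.LatticeQCDFlow.Exactness.MetropolisLinePositive
import Summits.Ventures.LatticeQCDFlow.Exactness.ConvolutionSquarePosDef
import Summits.Ventures.LatticeQCDFlow.Exactness.Phi4MetropolisPolyObsDCT
import Summits.Ventures.LatticeQCDFlow.Exactness.Phi4MetropolisMagnetisationMomentCSD
import HarnessLib

/-!
# The random-site Metropolis scan of lattice φ⁴ with a positive-definite (e.g. Gaussian) step law is a POSITIVE operator on `L²(e^{−S})`

HONEST FRAMING: exact (Metropolis-corrected) sampling algorithms for lattice gauge theory;
figures of merit are autocorrelation/cost numbers at stated couplings and volumes; no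
continuum-physics claim.  (SCALAR calibration rung S0-A: not a gauge result.)

Venture `LatticeQCDFlow` (cell pub-lqcd), topic `Exactness`; FANOUT row 2 (`s0-phi4`, LOCAL arm of
the 2D φ⁴ calibration: random-site single-site Metropolis `metroScan J λ ρ`).  NEW WORK of the cell
over `Exactness/MetropolisLinePositive.lean` (the line: Metropolis with a positive-definite step law
is positive on `L²(w)`; Rudolf–Ullrich 2013 Lemma 3.1 NAMED there), `Exactness/ConvolutionSquarePosDef.lean`
(the Gaussian step law is positive definite), row 2's Fubini-along-a-site reduction
(`integral_eq_integral_insertNth`, `insertNth_eq_update`, `integrable_gibbsWeight_line`) and the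
clip-and-dominate passage to `PolyObs` of `Exactness/Phi4MetropolisPolyObsDCT.lean`.  Nothing is
cited as a fact.

## What is proved (lattice `ℝ^Λ`, `Λ = Fin (n+1)`; coercive action `ε Σφ² − K ≤ S` — every `λ > 0`
with any real `J`; step law `ρ ≥ 0` measurable, `∫ρ = 1`, POSITIVE DEFINITE in the integrated sense
`0 ≤ ∫∫ G(t)G(t')ρ(t'−t)` for measurable integrable bounded `G`)

* **`metroSite_positive`** — every single-site hit is positive on bounded measurable observables:
  `0 ≤ ∫ f (M_x f) e^{−S}`;
* **`metroScan_positive`** — the random-site scan (average of the hits) is positive on `BddObs`;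
* **`metroScan_positive_poly`** — with all moments of `ρ`: positive on `PolyObs` (the magnetisation,
  the energy, all polynomial observables), by clipping and dominated convergence;
* **`metroScan_gaussian_positive_poly`**, **`metroScan_gaussian_positive_phi4`** — THE GAUSSIAN STEP
  LAW `N(0, v)`, every `v ≠ 0`, every `λ > 0`, every real `J`:
  `0 ≤ ⟨f · K f⟩_{e^{−S}}` for every `f ∈ PolyObs` — hypothesis (pos) of
  `Exactness/ReversiblePositive.lean` for the local arm, so that every consequence there and in
  `ReversiblePositiveTauInt` / `ReversiblePositiveThinning` (nonnegative, nonincreasing, convex,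
  log-convex autocovariances of EVERY observable; every window a floor; `τ_int ≥ ½`; thinning
  pinned; the per-sweep comparison theorem) applies to the local arm with Gaussian steps.

NOT CLAIMED: positivity for the uniform-window step law `U[−δ, δ]` (false in general — its Fourier
transform changes sign; negative lag-one autocorrelations are possible); the ordered sweep; any
number for any run.
-/

namespace Summit.Ventures.LatticeQCDFlow.Exactness

open Real MeasureTheory Filter Finset Topology ProbabilityTheory
open scoped NNReal
open Summit.Ventures.LatticeQCDFlow.Scoring

section Lattice

variable {n : ℕ}

/-! ## §1 The hit and the scan on bounded observables -/

/-- **EVERY SINGLE-SITE METROPOLIS HIT WITH A POSITIVE-DEFINITE STEP LAW IS POSITIVE**: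
`0 ≤ ∫ f (M_x f) e^{−S}` for bounded measurable `f` (Fubini along the site `x`: on each coordinate
line the hit IS the one-dimensional kernel, positive by `metropolis_line_positive`). -/
theorem metroSite_positive {J : Fin (n + 1) → Fin (n + 1) → ℝ} {lam ε K : ℝ} (hε : 0 < ε)
    (hS : ∀ φ : Fin (n + 1) → ℝ, ε * ∑ w, φ w ^ 2 - K ≤ latticePhi4Action J lam φ)
    (x : Fin (n + 1)) {ρ : ℝ → ℝ} (hρ0 : ∀ u, 0 ≤ ρ u) (hρm : Measurable ρ) (hρi : Integrable ρ)
    (hρ1 : ∫ u, ρ u = 1)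
    (hρpd : ∀ ⦃G : ℝ → ℝ⦄, Measurable G → Integrable G → ∀ ⦃C : ℝ⦄, (∀ t, |G t| ≤ C) →
      0 ≤ ∫ t, ∫ t', G t * G t' * ρ (t' - t))
    {f : (Fin (n + 1) → ℝ) → ℝ} (hfm : Measurable f) {Bf : ℝ} (hfb : ∀ φ, |f φ| ≤ Bf) :
    0 ≤ ∫ φ, f φ * metroSite J lam ρ x f φ * gibbsWeight J lam φ := by
  have hw_int : Integrable (gibbsWeight J lam) := integrable_gibbsWeight_of_coercive hε hS
  have hwc := (continuous_gibbsWeight J lam).aestronglyMeasurable (μ := volume)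
  have hBf : ∀ φ : Fin (n + 1) → ℝ, 0 ≤ Bf := fun φ => (abs_nonneg _).trans (hfb φ)
  have hG : Integrable (fun φ => f φ * metroSite J lam ρ x f φ * gibbsWeight J lam φ) := by
    refine Integrable.mono' (hw_int.const_mul (Bf * Bf))
      ((hfm.aestronglyMeasurable.mul (measurable_metroSite J lam hρm x hfm).aestronglyMeasurable).mul
        hwc) (Eventually.of_forall fun φ => ?_)
    rw [Real.norm_eq_abs, abs_mul, abs_mul, abs_of_pos (gibbsWeight_pos J lam φ)]
    refine mul_le_mul_of_nonneg_right ?_ (gibbsWeight_pos J lam φ).le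
    exact mul_le_mul (hfb φ) (abs_metroSite_le J lam hρ0 hρi hρ1 x hfb φ) (abs_nonneg _) (hBf φ)
  rw [integral_eq_integral_insertNth x hG]
  refine integral_nonneg fun x' => ?_
  set ψ : Fin (n + 1) → ℝ := Fin.insertNth x (0 : ℝ) x' with hψ
  have hψx : ψ x = 0 := by simp [hψ]
  have hins : ∀ t : ℝ, (Fin.insertNth x t x' : Fin (n + 1) → ℝ) = Function.update ψ x t :=
    fun t => insertNth_eq_update x t x'
  simp only [hins]
  set w : ℝ → ℝ := fun t => gibbsWeight J lam (Function.update ψ x t) with hw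
  have hw0 : ∀ t, 0 < w t := fun t => gibbsWeight_pos J lam _
  have hwm : Measurable w :=
    ((continuous_gibbsWeight J lam).measurable.comp
      (measurable_update' (a := x) |>.comp (measurable_const.prodMk measurable_id)))
  have hwi : Integrable w := integrable_gibbsWeight_line hε hS ψ x hψx
  have hfl : Measurable fun t => f (Function.update ψ x t) :=
    hfm.comp (measurable_update' (a := x) |>.comp (measurable_const.prodMk measurable_id))
  -- the lattice operator along the line IS the one-dimensional kernel
  have hK : ∀ t : ℝ, metroSite J lam ρ x f (Function.update ψ x t)
      = ∫ t', (min 1 (w t' / w t) * f (Function.update ψ x t')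
          + (1 - min 1 (w t' / w t)) * f (Function.update ψ x t)) * ρ (t' - t) := by
    intro t
    unfold metroSite metroAccept
    simp only [Function.update_idem, Function.update_self, hw]
  simp only [hK]
  exact metropolis_line_positive hw0 hwm hwi hρ0 hρm hρi hρ1 hρpd hfl (fun t => hfb _)

/-- **THE RANDOM-SITE SCAN WITH A POSITIVE-DEFINITE STEP LAW IS POSITIVE ON `BddObs`**:
`0 ≤ ∫ f (K f) e^{−S}`, `K = (1/V) Σ_x M_x`. -/
theorem metroScan_positive {J : Fin (n + 1) → Fin (n + 1) → ℝ} {lam ε K : ℝ} (hε : 0 < ε)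
    (hS : ∀ φ : Fin (n + 1) → ℝ, ε * ∑ w, φ w ^ 2 - K ≤ latticePhi4Action J lam φ)
    {ρ : ℝ → ℝ} (hρ0 : ∀ u, 0 ≤ ρ u) (hρm : Measurable ρ) (hρi : Integrable ρ)
    (hρ1 : ∫ u, ρ u = 1)
    (hρpd : ∀ ⦃G : ℝ → ℝ⦄, Measurable G → Integrable G → ∀ ⦃C : ℝ⦄, (∀ t, |G t| ≤ C) →
      0 ≤ ∫ t, ∫ t', G t * G t' * ρ (t' - t))
    {f : (Fin (n + 1) → ℝ) → ℝ} (hf : BddObs f) :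
    0 ≤ ∫ φ, f φ * metroScan J lam ρ f φ * gibbsWeight J lam φ := by
  have hn : (0 : ℝ) < (n : ℝ) + 1 := by positivity
  have e : ∀ φ, f φ * metroScan J lam ρ f φ * gibbsWeight J lam φ
      = (∑ x, f φ * metroSite J lam ρ x f φ * gibbsWeight J lam φ) / ((n : ℝ) + 1) := by
    intro φ
    unfold metroScan
    rw [Finset.sum_div, Finset.mul_sum, Finset.sum_mul, Finset.sum_div]
    exact Finset.sum_congr rfl fun x _ => by ring
  simp_rw [e]
  have hint : ∀ x, Integrable (fun φ => f φ * metroSite J lam ρ x f φ * gibbsWeight J lam φ) :=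
    fun x => bddObs_integrable_mul_mul_gibbsWeight hε hS hf (bddObs_metroSite J lam hρ0 hρm hρi hρ1 x hf)
  rw [integral_div, integral_finsetSum _ fun x _ => hint x]
  obtain ⟨hfm, Bf, hfb⟩ := hf
  exact div_nonneg (Finset.sum_nonneg fun x _ =>
    metroSite_positive hε hS x hρ0 hρm hρi hρ1 hρpd hfm hfb) hn.le

/-! ## §2 Polynomial observables (clip and dominate) -/

/-- **THE RANDOM-SITE SCAN WITH A POSITIVE-DEFINITE STEP LAW WITH ALL MOMENTS IS POSITIVE ON
`PolyObs`**: `0 ≤ ∫ f (K f) e^{−S}` for every polynomial-envelope observable (magnetisation, energy,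
their powers). -/
theorem metroScan_positive_poly {J : Fin (n + 1) → Fin (n + 1) → ℝ} {lam ε K : ℝ} (hε : 0 < ε)
    (hS : ∀ φ : Fin (n + 1) → ℝ, ε * ∑ w, φ w ^ 2 - K ≤ latticePhi4Action J lam φ)
    {ρ : ℝ → ℝ} (hρ0 : ∀ u, 0 ≤ ρ u) (hρm : Measurable ρ) (hρi : Integrable ρ)
    (hρ1 : ∫ u, ρ u = 1) (hρmom : ∀ j : ℕ, Integrable (fun u => (1 + |u|) ^ j * ρ u))
    (hρpd : ∀ ⦃G : ℝ → ℝ⦄, Measurable G → Integrable G → ∀ ⦃C : ℝ⦄, (∀ t, |G t| ≤ C) →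
      0 ≤ ∫ t, ∫ t', G t * G t' * ρ (t' - t))
    {f : (Fin (n + 1) → ℝ) → ℝ} (hf : PolyObs f) :
    0 ≤ ∫ φ, f φ * metroScan J lam ρ f φ * gibbsWeight J lam φ := by
  obtain ⟨hfm, Bf, kf, hfb0⟩ := hf
  have hfb := abs_le_abs_mul_env hfb0
  have hBf : 0 ≤ |Bf| := abs_nonneg _
  set μf := ∫ u, (1 + |u|) ^ (2 * kf) * ρ u with hμf
  have hEnv := integrable_env_pow_mul_gibbsWeight hε hS (kf + kf)
  have hwm : Measurable (gibbsWeight J lam) := (continuous_gibbsWeight J lam).measurable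
  set fN : ℕ → (Fin (n + 1) → ℝ) → ℝ := fun N ψ => max (-(N : ℝ)) (min (N : ℝ) (f ψ)) with hfN
  have hfNb : ∀ N, BddObs (fN N) := fun N => bddObs_clip hfm N
  have hN : ∀ N, 0 ≤ ∫ φ, fN N φ * metroScan J lam ρ (fN N) φ * gibbsWeight J lam φ :=
    fun N => metroScan_positive hε hS hρ0 hρm hρi hρ1 hρpd (hfNb N)
  have hKfN : ∀ N φ, |metroScan J lam ρ (fN N) φ| ≤ |Bf| * μf * (1 + ∑ w, φ w ^ 2) ^ kf :=
    fun N φ => abs_metroScan_le_poly J lam hρ0 hρm (hρmom (2 * kf)) (hfNb N).1 hBf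
      (clip_polyBound hfb N) φ
  have hμf0 : 0 ≤ μf := integral_nonneg fun u => mul_nonneg (by positivity) (hρ0 u)
  have henv0 : ∀ (φ : Fin (n + 1) → ℝ) j, 0 ≤ (1 + ∑ w, φ w ^ 2) ^ j :=
    fun φ j => pow_nonneg (zero_le_one.trans (one_le_env φ)) _
  have hL : Tendsto (fun N => ∫ φ, fN N φ * metroScan J lam ρ (fN N) φ * gibbsWeight J lam φ)
      atTop (𝓝 (∫ φ, f φ * metroScan J lam ρ f φ * gibbsWeight J lam φ)) := by
    refine tendsto_integral_of_dominated_convergence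
      (fun φ => |Bf| * (|Bf| * μf) * ((1 + ∑ w, φ w ^ 2) ^ (kf + kf) * gibbsWeight J lam φ))
      (fun N => (((hfNb N).1.mul
        (polyObs_metroScan J lam hρ0 hρm hρmom (polyObs_of_bddObs (hfNb N))).1).mul
          hwm).aestronglyMeasurable)
      (hEnv.const_mul _) (fun N => Eventually.of_forall fun φ => ?_)
      (Eventually.of_forall fun φ => ?_)
    · have hw := gibbsWeight_pos J lam φ
      rw [Real.norm_eq_abs, abs_mul, abs_mul, abs_of_pos hw, pow_add]
      calc |fN N φ| * |metroScan J lam ρ (fN N) φ| * gibbsWeight J lam φ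
          ≤ (|Bf| * (1 + ∑ w, φ w ^ 2) ^ kf) * (|Bf| * μf * (1 + ∑ w, φ w ^ 2) ^ kf)
            * gibbsWeight J lam φ := by
            refine mul_le_mul_of_nonneg_right ?_ hw.le
            exact mul_le_mul (clip_polyBound hfb N φ) (hKfN N φ) (abs_nonneg _)
              (mul_nonneg hBf (henv0 φ kf))
        _ = |Bf| * (|Bf| * μf) * ((1 + ∑ w, φ w ^ 2) ^ kf * (1 + ∑ w, φ w ^ 2) ^ kf
            * gibbsWeight J lam φ) := by ring
    · exact ((tendsto_clip (f φ)).mul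
        (tendsto_metroScan_clip_poly J lam hρ0 hρm (hρmom (2 * kf)) hfm hBf hfb φ)).mul_const _
  exact ge_of_tendsto' hL hN

/-! ## §3 The Gaussian step law -/

/-- **THE LOCAL ARM WITH GAUSSIAN STEPS IS A POSITIVE OPERATOR ON `PolyObs`** (coercive action —
every `λ > 0`, real `J`; step law `N(0, v)`, any `v ≠ 0`):  `0 ≤ ∫ f (K f) e^{−S}` for every
`f ∈ PolyObs`. -/
theorem metroScan_gaussian_positive_poly {J : Fin (n + 1) → Fin (n + 1) → ℝ} {lam ε K : ℝ}
    (hε : 0 < ε) (hS : ∀ φ : Fin (n + 1) → ℝ, ε * ∑ w, φ w ^ 2 - K ≤ latticePhi4Action J lam φ)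
    {v : ℝ≥0} (hv : v ≠ 0) {f : (Fin (n + 1) → ℝ) → ℝ} (hf : PolyObs f) :
    0 ≤ ∫ φ, f φ * metroScan J lam (gaussianPDFReal 0 v) f φ * gibbsWeight J lam φ :=
  metroScan_positive_poly hε hS (fun u => gaussianPDFReal_nonneg 0 v u)
    (measurable_gaussianPDFReal 0 v) (integrable_gaussianPDFReal 0 v)
    (integral_gaussianPDFReal_eq_one 0 hv) (gaussianPDFReal_moments hv)
    (fun _ hGm hGi _ _ => gaussian_posDef hv hGm hGi) hf

/-- **φ⁴ form**: every `λ > 0`, every real `J`, every Gaussian step law `N(0, v)` (`v ≠ 0`), every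
`f ∈ PolyObs`:  `0 ≤ ⟨f · K f⟩` in the φ⁴ Gibbs law — hypothesis (pos) of
`Exactness/ReversiblePositive.lean` for row 2's local arm. -/
theorem metroScan_gaussian_positive_phi4 {lam : ℝ} (hlam : 0 < lam)
    (J : Fin (n + 1) → Fin (n + 1) → ℝ) {v : ℝ≥0} (hv : v ≠ 0)
    {f : (Fin (n + 1) → ℝ) → ℝ} (hf : PolyObs f) :
    0 ≤ gibbsExpect J lam (fun φ => f φ * metroScan J lam (gaussianPDFReal 0 v) f φ) := by
  unfold gibbsExpect
  exact div_nonneg (metroScan_gaussian_positive_poly one_pos (latticePhi4Action_coercive hlam J) hv hf)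
    (gibbsZ_pos hlam J).le

end Lattice

end Summit.Ventures.LatticeQCDFlow.Exactness
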